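import Mathlib
import HarnessLib
import Summits.ValiantsHypothesis.ValiantsHypothesis.Theses.MonotoneRestoration
import Literature.Computability.AlgebraicComplexity.ArithCircuit
import Literature.Computability.AlgebraicComplexity.ArithCircuitProofs
import Literature.Computability.AlgebraicComplexity.MonotoneStructure
import Literature.Computability.AlgebraicComplexity.PermanentIrreducible
import Literature.ModelTheory.FiniteModelTheory.CkEquiv
import Summits.ValiantsHypothesis.ValiantsHypothesis.Theorems.MonotoneRestorationMonotoneRestorationQPCosetCount
import Summits.ValiantsHypothesis.ValiantsHypothesis.Theorems.MonotoneRestorationMonotoneRestorationQPSymmetricLB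
import Summits.ValiantsHypothesis.ValiantsHypothesis.Theorems.MonotoneRestorationMonotoneRestorationQPSupportSymmetrisation
import Summits.ValiantsHypothesis.ValiantsHypothesis.Theorems.MonotoneRestorationMonotoneRestorationQPSparseRegime
import Summits.ValiantsHypothesis.ValiantsHypothesis.Theorems.MonotoneRestorationMonotoneRestorationQPBeta
import Literature.Computability.AlgebraicComplexity.SymmetricArithCircuit
import Literature.Computability.AlgebraicComplexity.DawarWilsenach2025Proofs
import Literature.GroupTheory.PermutationGroups.SmallIndexSubgroups
import Summits.ValiantsHypothesis.ValiantsHypothesis.Theorems.MonotoneRestorationQP.Negative.LoadBearing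
import Summits.ValiantsHypothesis.ValiantsHypothesis.Theorems.MonotoneRestorationMonotoneRestorationQPPermSupportCount
import Summits.ValiantsHypothesis.ValiantsHypothesis.Theorems.MonotoneRestorationMonotoneRestorationQPEsymmRowSumsStructure

/-! TTRL-lite variant V19147 of stmt-ValiantsHypothesis-15886 -/

-- `Summit.ValiantsHypothesis.ValiantsHypothesis.…` is the tree's mandated single-conjunct layout
-- (Sub = Summit), so the duplicated namespace component is intended.
set_option linter.dupNamespace false

namespace Summit.ValiantsHypothesis.ValiantsHypothesis.Theorems

open Summit.ValiantsHypothesis.ValiantsHypothesis.Theses.MonotoneRestoration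
open Literature.Computability.AlgebraicComplexity

/-- **TTRL-lite variant V19147** (negation of the tempting set-multilinear strengthening) of
`stub_esymmRowSums_structure` (`stmt-ValiantsHypothesis-15886`): for `n ≥ 1` the witness
`e_{⌊n/2⌋}(R₀, …, R_{n-1})` (`Rᵢ = ∑ j, X (i, j)`, over `ℝ≥0`) is NOT fully ordered
(set-multilinear in the rows).  Proof: it is nonzero and homogeneous of degree `⌊n/2⌋`
(`stub_esymmRowSums_structure`), while a fully ordered polynomial is homogeneous of degree
`n` (`IsFullyOrdered.isHomogeneous`); a nonzero polynomial has only one degree of homogeneity,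
and `⌊n/2⌋ < n` for `n ≥ 1`. [folklore] -/
theorem stub_esymmRowSums_structure_var19147 :
    ∀ (n : ℕ), 0 < n → ¬ Literature.Computability.AlgebraicComplexity.IsFullyOrdered
      (MvPolynomial.bind₁ (fun i : Fin n => ∑ j : Fin n, MvPolynomial.X (i, j))
        (MvPolynomial.esymm (Fin n) NNReal (n / 2))) := by
  intro n hn h
  obtain ⟨hhom, -, hne, -⟩ := stub_esymmRowSums_structure n
  have hcard := hhom.inj_right h.isHomogeneous hne
  rw [Fintype.card_fin] at hcard
  omega

end Summit.ValiantsHypothesis.ValiantsHypothesis.Theorems
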